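import Literature.AlgebraicGeometry.Motives.HodgeStructureCentralizerDiagonalActionPoints
import HarnessLib

/-!
# «`C'(A) ≅ C(A) ⊗_k k'`, `S'(A) ≅ S(A)_{/k'}`» — THE RESTRICTION ISOMORPHISMS OF PROP. 1.1 ∕ 1.5 COMMUTE WITH BASE CHANGE:
# on `γ_K = 1 ⊗ γ` every map over the base-changed restrictions (blocks, diagonal action, canonical block; `C` and `S`) IS the base
# change of the corresponding map over the `ℚ`-restrictions — `E(γ_K) = (e γ)_K`, `F(g_K) = (r g)_K` (Milne 1999 §1 Prop. 1.1, 1.5, Remark 1.6)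

[topic AlgebraicGeometry/Motives]

Layer `Literature/AlgebraicGeometry/Motives`, lane `lit-hodgefound` (Track 2 foundations library; prover seat
`lit-hodgefound-p02`, generation 53, self-proposed row g53-#12). THEOREMS ONLY: no definition, no named fact (net debt `0`),
no instance, no notation.  The gen-53 files give Milne's restriction isomorphisms twice, over `ℚ` (g53-#1∕#2∕#3∕#4, g52-#3∕#4:
`(e γ)_k v = γ v`, `(e γ)(rᵢ x) = rᵢ(γ x)`, `(e γ) u = γ u`) and on `K`-points (g53-#6∕#7∕#8∕#10: the same with `(·)_K`), each map
characterised by its formula.  This file records, for ANY pair of such maps, that the `K`-map restricted to the `ℚ`-points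
`γ ↦ γ_K = γ.baseChange K` (p34's `glBaseChange K V : GL(V) →* GL(K ⊗ V)`, `Polarization.lefschetzGroup_le_comap_lefschetzGroupBaseChange`)
is the base change of the `ℚ`-map — the naturality in Remark 1.6 that makes the isomorphisms «canonical».  Pure linear algebra over the
formulas: `(ι_k)_K ∘ E(γ_K)_k = γ_K ∘ (ι_k)_K = (γ ∘ ι_k)_K = (ι_k ∘ (e γ)_k)_K` and `(ι_k)_K` is injective (`K` flat over `ℚ`), resp.
the `(Rᵢ)_K (K ⊗ W₀)` span `K ⊗ V'` (g53-#8's `linearMap_eq_of_forall_apply_baseChange_hom_eq`) — BY NAME, nothing restated.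

## The source, verbatim

J. S. Milne, *Lefschetz classes on abelian varieties*, Duke Math. J. 96 (1999) 639–675 [Milne1999LefschetzClasses] (held
`paper:doi-10-1215-s0012-7094-99-09620-5`), §1 p. 644 L29–L34: "**Remark 1.6.** If `X → H*(X)` is a Weil cohomology theory with
coefficient field `k`, and `k'` is a field containing `k`, then `X → H*(X) ⊗_k k'` is a Weil cohomology theory with coefficient field
`k'`. If `C'(A)` and `S'(A)` denote the objects defined relative to the second theory, then there are canonical isomorphisms
`C'(A) ≅ C(A) ⊗_k k'`, `S'(A) ≅ S(A)_{/k'}`."; p. 643 L7–L15 (Prop. 1.1, the diagonal action, «`C(B) ⊂ C(A₁) × ⋯ × C(A_s)`») and p. 644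
L16–L28 (`S(A)(R) = {γ ∈ C(A) ⊗_k R | γ†γ = 1}`, Prop. 1.5 «independent of the choice of the isogeny»).  Base change of homomorphisms:
N. Bourbaki [BourbakiAlgebraI1989] Ch. II §5 no. 1 Prop. 4 and no. 3 Prop. 7; D. Huybrechts [Huybrechts2016K3] §3.3.5.

## Dictionary and what is proved (namespace `Literature.AlgebraicGeometry.Motives.HodgeStructure`)

`γ_K = (γ : End_ℚ V).baseChange K`, `g_K = glBaseChange K V g = g.baseChange ℚ K V V`, `(ι_k)_K = (W k).toSubmodule.subtype.baseChange K`,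
`Rᵢ = ιᵢ ∘ rᵢ`, `j = Submodule.inclusion hUS`.

* §0 `baseChange_mem_centralizer_endAlg_baseChange` (`γ ∈ C(H) ⟹ γ_K ∈ C(H)(K)`).
* §1 (blocks `W_k` of `H`, any family) **`coe_map_baseChange_eq_baseChange_coe_map`** (`C`: `(E γ_K)_k = ((e γ)_k)_K`),
  **`Polarization.coe_map_glBaseChange_eq_glBaseChange_map`** (`S`: `(F g_K)_k = ((r g)_k)_K`).
* §2 (diagonal action, `V' = ⊕ᵢ Tᵢ`, `rᵢ : H₀ ⥲ Tᵢ`) **`coe_map_baseChange_eq_baseChange_coe_map_of_forall_apply_hom_eq`**,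
  **`Polarization.coe_map_glBaseChange_eq_glBaseChange_map_of_forall_apply_hom_eq`**.
* §3 (canonical block `U ≤ S`) **`coe_map_baseChange_eq_baseChange_coe_map_of_le`**, **`Polarization.coe_map_glBaseChange_eq_glBaseChange_map_of_le`**.
-/

noncomputable section

open scoped TensorProduct

namespace Literature.AlgebraicGeometry.Motives

namespace HodgeStructure

universe u uK

variable (K : Type uK) [Field K] [Algebra ℚ K] {n : ℤ}

/-! ## §0 `γ ↦ γ_K` maps `C(H)` into `C(H)(K)` -/

section Points

variable {V : Type u} [AddCommGroup V] [Module ℚ V] {H : HodgeStructure V n}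

/-- **`γ ∈ C(H) ⟹ γ_K ∈ C(H)(K)`** (`γ_K` commutes with every `a_K`, `a ∈ E_φ`): the `ℚ`-points of Milne's `C(A)` inside its `K`-points,
«`C'(A) ≅ C(A) ⊗_k k'`» on `1 ⊗ γ`. [cite: Milne1999LefschetzClasses, §1 Remark 1.6 (p. 644)] -/
theorem baseChange_mem_centralizer_endAlg_baseChange {γ : Module.End ℚ V}
    (hγ : γ ∈ Subalgebra.centralizer ℚ (H.endAlg : Set (Module.End ℚ V))) :
    γ.baseChange K ∈ Subalgebra.centralizer K ((fun a : Module.End ℚ V => a.baseChange K) '' (H.endAlg : Set (Module.End ℚ V))) := by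
  simpa only [one_smul] using smul_baseChange_mem_centralizer_endAlg_baseChange K H (1 : K) hγ

end Points

/-! ## §1 Along the blocks of an internal direct sum -/

section Blocks

variable {V : Type u} [AddCommGroup V] [Module ℚ V] {H : HodgeStructure V n} {κ : Type*} (W : κ → SubHodgeStructure H)

/-- **`(E γ_K)_k = ((e γ)_k)_K`** — the `K`-point restriction map over the blocks IS the base change of the `ℚ`-restriction map on
`ℚ`-points: for ANY `e : C(H) → Π_k C(W_k)` over the restrictions (`(e γ)_k v = γ v`) and ANY `E : C(H)(K) → Π_k C(W_k)(K)` over the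
base-changed restrictions (`(ι_k)_K ((E c)_k x) = c ((ι_k)_K x)`), since `(ι_k)_K ∘ (E γ_K)_k = (γ ∘ ι_k)_K = (ι_k ∘ (e γ)_k)_K` and
`(ι_k)_K` is injective. [cite: Milne1999LefschetzClasses, §1 Prop. 1.1 (p. 643) and Remark 1.6 (p. 644)] [cite: BourbakiAlgebraI1989, Ch. II §5 no. 3 Prop. 7] -/
theorem coe_map_baseChange_eq_baseChange_coe_map
    (e : Subalgebra.centralizer ℚ (H.endAlg : Set (Module.End ℚ V)) →
      Π k, Subalgebra.centralizer ℚ ((W k).toHodgeStructure.endAlg : Set (Module.End ℚ (W k).toSubmodule)))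
    (he : ∀ (c : Subalgebra.centralizer ℚ (H.endAlg : Set (Module.End ℚ V))) (k : κ) (v : (W k).toSubmodule),
      ((e c k : Module.End ℚ (W k).toSubmodule) v : V) = (c : Module.End ℚ V) v)
    (E : Subalgebra.centralizer K ((fun a : Module.End ℚ V => a.baseChange K) '' (H.endAlg : Set (Module.End ℚ V))) →
      Π k, Subalgebra.centralizer K ((fun a : Module.End ℚ (W k).toSubmodule => a.baseChange K) ''
        ((W k).toHodgeStructure.endAlg : Set (Module.End ℚ (W k).toSubmodule))))
    (hE : ∀ (c : Subalgebra.centralizer K ((fun a : Module.End ℚ V => a.baseChange K) '' (H.endAlg : Set (Module.End ℚ V))))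
      (k : κ) (x : K ⊗[ℚ] (W k).toSubmodule),
      (W k).toSubmodule.subtype.baseChange K
          (((E c k : Subalgebra.centralizer K ((fun a : Module.End ℚ (W k).toSubmodule => a.baseChange K) ''
            ((W k).toHodgeStructure.endAlg : Set (Module.End ℚ (W k).toSubmodule)))) : Module.End K (K ⊗[ℚ] (W k).toSubmodule)) x) =
        (c : Module.End K (K ⊗[ℚ] V)) ((W k).toSubmodule.subtype.baseChange K x))
    (γ : Subalgebra.centralizer ℚ (H.endAlg : Set (Module.End ℚ V))) (k : κ) :
    ((E ⟨(γ : Module.End ℚ V).baseChange K, baseChange_mem_centralizer_endAlg_baseChange K γ.2⟩ k : Subalgebra.centralizer K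
        ((fun a : Module.End ℚ (W k).toSubmodule => a.baseChange K) '' ((W k).toHodgeStructure.endAlg : Set (Module.End ℚ (W k).toSubmodule)))) :
          Module.End K (K ⊗[ℚ] (W k).toSubmodule)) =
      ((e γ k : Subalgebra.centralizer ℚ ((W k).toHodgeStructure.endAlg : Set (Module.End ℚ (W k).toSubmodule))) :
        Module.End ℚ (W k).toSubmodule).baseChange K := by
  have hinj : Function.Injective ((W k).toSubmodule.subtype.baseChange K) := by
    rw [LinearMap.baseChange_eq_ltensor]
    exact Module.Flat.lTensor_preserves_injective_linearMap _ (W k).toSubmodule.injective_subtype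
  have hq : (W k).toSubmodule.subtype ∘ₗ (e γ k : Module.End ℚ (W k).toSubmodule) = (γ : Module.End ℚ V) ∘ₗ (W k).toSubmodule.subtype :=
    LinearMap.ext fun v => he γ k v
  refine LinearMap.ext fun x => hinj ?_
  rw [hE, ← LinearMap.comp_apply ((W k).toSubmodule.subtype.baseChange K), ← LinearMap.baseChange_comp, hq, LinearMap.baseChange_comp,
    LinearMap.comp_apply]

/-- **`(F g_K)_k = ((r g)_k)_K`** — «`S'(A) ≅ S(A)_{/k'}`» is compatible with Prop. 1.5: for ANY `r : S(H)(ℚ) → Π_k S(W_k)(ℚ)` over the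
restrictions and ANY `F : S(H)(K) → Π_k S(W_k)(K)` over the base-changed restrictions, `F` on the `ℚ`-point `g_K = 1 ⊗ g` (p34's
`glBaseChange`, `lefschetzGroup_le_comap_lefschetzGroupBaseChange`) is the base change of `r g`.
[cite: Milne1999LefschetzClasses, §1 Prop. 1.5 and Remark 1.6 (p. 644)] [cite: BourbakiAlgebraI1989, Ch. II §5 no. 3 Prop. 7] -/
theorem Polarization.coe_map_glBaseChange_eq_glBaseChange_map (ψ : Polarization H)
    (r : ψ.lefschetzGroup → Π k, (ψ.restrict (W k)).lefschetzGroup)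
    (hr : ∀ (g : ψ.lefschetzGroup) (k : κ) (v : (W k).toSubmodule),
      ((r g k : (W k).toSubmodule ≃ₗ[ℚ] (W k).toSubmodule) v : V) = (g : V ≃ₗ[ℚ] V) v)
    (F : ψ.lefschetzGroupBaseChange K → Π k, (ψ.restrict (W k)).lefschetzGroupBaseChange K)
    (hF : ∀ (g : ψ.lefschetzGroupBaseChange K) (k : κ) (x : K ⊗[ℚ] (W k).toSubmodule),
      (W k).toSubmodule.subtype.baseChange K
          ((F g k : (K ⊗[ℚ] (W k).toSubmodule) ≃ₗ[K] (K ⊗[ℚ] (W k).toSubmodule)) x) =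
        (g : (K ⊗[ℚ] V) ≃ₗ[K] (K ⊗[ℚ] V)) ((W k).toSubmodule.subtype.baseChange K x))
    (g : ψ.lefschetzGroup) (k : κ) :
    ((F ⟨glBaseChange K V (g : V ≃ₗ[ℚ] V),
          Subgroup.mem_comap.1 (ψ.lefschetzGroup_le_comap_lefschetzGroupBaseChange K g.2)⟩ k :
        (ψ.restrict (W k)).lefschetzGroupBaseChange K) : (K ⊗[ℚ] (W k).toSubmodule) ≃ₗ[K] (K ⊗[ℚ] (W k).toSubmodule)) =
      glBaseChange K (W k).toSubmodule (r g k : (W k).toSubmodule ≃ₗ[ℚ] (W k).toSubmodule) := by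
  have hinj : Function.Injective ((W k).toSubmodule.subtype.baseChange K) := by
    rw [LinearMap.baseChange_eq_ltensor]
    exact Module.Flat.lTensor_preserves_injective_linearMap _ (W k).toSubmodule.injective_subtype
  have hq : (W k).toSubmodule.subtype ∘ₗ ((r g k : (W k).toSubmodule ≃ₗ[ℚ] (W k).toSubmodule) : Module.End ℚ (W k).toSubmodule) =
      ((g : V ≃ₗ[ℚ] V) : Module.End ℚ V) ∘ₗ (W k).toSubmodule.subtype :=
    LinearMap.ext fun v => hr g k v
  have h2 : (((g : V ≃ₗ[ℚ] V).baseChange ℚ K V V : (K ⊗[ℚ] V) ≃ₗ[K] (K ⊗[ℚ] V)) : Module.End K (K ⊗[ℚ] V)) ∘ₗ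
      (W k).toSubmodule.subtype.baseChange K =
        (W k).toSubmodule.subtype.baseChange K ∘ₗ (((r g k : (W k).toSubmodule ≃ₗ[ℚ] (W k).toSubmodule).baseChange ℚ K _ _ :
          (K ⊗[ℚ] (W k).toSubmodule) ≃ₗ[K] (K ⊗[ℚ] (W k).toSubmodule)) : Module.End K (K ⊗[ℚ] (W k).toSubmodule)) := by
    rw [LinearEquiv.coe_baseChange, LinearEquiv.coe_baseChange, ← LinearMap.baseChange_comp, ← LinearMap.baseChange_comp, hq]
  refine LinearEquiv.ext fun x => hinj ?_
  rw [hF]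
  exact LinearMap.congr_fun h2 x

end Blocks

/-! ## §2 The diagonal action -/

section Diagonal

variable {V' : Type u} [AddCommGroup V'] [Module ℚ V'] {H' : HodgeStructure V' n}
  {W₀ : Type u} [AddCommGroup W₀] [Module ℚ W₀] {H₀ : HodgeStructure W₀ n}
  {ι : Type} [DecidableEq ι] (T : ι → SubHodgeStructure H') (hT : DirectSum.IsInternal fun i => (T i).toSubmodule)
  (r : ∀ i, Hom H₀ (T i).toHodgeStructure) (hr : ∀ i, Function.Bijective (r i).toLinearMap)

include hT hr

/-- **`E(γ_K) = (e γ)_K` for the diagonal action** («the diagonal action of `C(A)` on `rV(A)` identifies `C(A)` with `C(A^r)`», read through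
Remark 1.6): for ANY `e : C(H₀) → C(H')` acting diagonally over `ℚ` (`(e γ)(Rᵢ x) = Rᵢ(γ x)`) and ANY `E : C(H₀)(K) → C(H')(K)` acting
diagonally on `K`-points (`(E c)((Rᵢ)_K x) = (Rᵢ)_K (c x)`) — both `E(γ_K)` and `(e γ)_K` act diagonally by `γ_K`, and the `(Rᵢ)_K (K ⊗ W₀)`
span `K ⊗ V'` (g53-#8). [cite: Milne1999LefschetzClasses, §1 p. 643 L12–L13 and Remark 1.6 (p. 644)] -/
theorem coe_map_baseChange_eq_baseChange_coe_map_of_forall_apply_hom_eq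
    (e : Subalgebra.centralizer ℚ (H₀.endAlg : Set (Module.End ℚ W₀)) → Subalgebra.centralizer ℚ (H'.endAlg : Set (Module.End ℚ V')))
    (he : ∀ (γ₀ : Subalgebra.centralizer ℚ (H₀.endAlg : Set (Module.End ℚ W₀))) (i : ι) (x : W₀),
      ((e γ₀ : Subalgebra.centralizer ℚ (H'.endAlg : Set (Module.End ℚ V'))) : Module.End ℚ V')
          (((r i).toLinearMap x : (T i).toSubmodule) : V') = (((r i).toLinearMap ((γ₀ : Module.End ℚ W₀) x) : (T i).toSubmodule) : V'))
    (E : Subalgebra.centralizer K ((fun a : Module.End ℚ W₀ => a.baseChange K) '' (H₀.endAlg : Set (Module.End ℚ W₀))) →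
      Subalgebra.centralizer K ((fun a : Module.End ℚ V' => a.baseChange K) '' (H'.endAlg : Set (Module.End ℚ V'))))
    (hE : ∀ (c : Subalgebra.centralizer K ((fun a : Module.End ℚ W₀ => a.baseChange K) '' (H₀.endAlg : Set (Module.End ℚ W₀))))
      (i : ι) (x : K ⊗[ℚ] W₀),
      ((E c : Subalgebra.centralizer K ((fun a : Module.End ℚ V' => a.baseChange K) '' (H'.endAlg : Set (Module.End ℚ V')))) :
          Module.End K (K ⊗[ℚ] V')) (((T i).toSubmodule.subtype ∘ₗ (r i).toLinearMap).baseChange K x) =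
        ((T i).toSubmodule.subtype ∘ₗ (r i).toLinearMap).baseChange K ((c : Module.End K (K ⊗[ℚ] W₀)) x))
    (γ₀ : Subalgebra.centralizer ℚ (H₀.endAlg : Set (Module.End ℚ W₀))) :
    ((E ⟨(γ₀ : Module.End ℚ W₀).baseChange K, baseChange_mem_centralizer_endAlg_baseChange K γ₀.2⟩ : Subalgebra.centralizer K
        ((fun a : Module.End ℚ V' => a.baseChange K) '' (H'.endAlg : Set (Module.End ℚ V')))) : Module.End K (K ⊗[ℚ] V')) =
      ((e γ₀ : Subalgebra.centralizer ℚ (H'.endAlg : Set (Module.End ℚ V'))) : Module.End ℚ V').baseChange K := by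
  have hq : ∀ i, ((e γ₀ : Subalgebra.centralizer ℚ (H'.endAlg : Set (Module.End ℚ V'))) : Module.End ℚ V') ∘ₗ
      ((T i).toSubmodule.subtype ∘ₗ (r i).toLinearMap) =
        ((T i).toSubmodule.subtype ∘ₗ (r i).toLinearMap) ∘ₗ (γ₀ : Module.End ℚ W₀) := fun i =>
    LinearMap.ext fun x => by
      rw [LinearMap.comp_apply, LinearMap.comp_apply, LinearMap.comp_apply, LinearMap.comp_apply, Submodule.subtype_apply,
        Submodule.subtype_apply]
      exact he γ₀ i x
  have h1 : ∀ i, ((E ⟨(γ₀ : Module.End ℚ W₀).baseChange K, baseChange_mem_centralizer_endAlg_baseChange K γ₀.2⟩ :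
      Subalgebra.centralizer K ((fun a : Module.End ℚ V' => a.baseChange K) '' (H'.endAlg : Set (Module.End ℚ V')))) :
        Module.End K (K ⊗[ℚ] V')) ∘ₗ ((T i).toSubmodule.subtype ∘ₗ (r i).toLinearMap).baseChange K =
          ((T i).toSubmodule.subtype ∘ₗ (r i).toLinearMap).baseChange K ∘ₗ (γ₀ : Module.End ℚ W₀).baseChange K := fun i =>
    LinearMap.ext fun x => hE _ i x
  have h2 : ∀ i, ((T i).toSubmodule.subtype ∘ₗ (r i).toLinearMap).baseChange K ∘ₗ (γ₀ : Module.End ℚ W₀).baseChange K =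
      ((e γ₀ : Subalgebra.centralizer ℚ (H'.endAlg : Set (Module.End ℚ V'))) : Module.End ℚ V').baseChange K ∘ₗ
        ((T i).toSubmodule.subtype ∘ₗ (r i).toLinearMap).baseChange K := fun i => by
    rw [← LinearMap.baseChange_comp, ← LinearMap.baseChange_comp, hq i]
  exact linearMap_eq_of_forall_apply_baseChange_hom_eq K T hT r hr _ _ fun i x => LinearMap.congr_fun ((h1 i).trans (h2 i)) x

/-- **`F(g_K) = (e g)_K` for the diagonal action on `S`**: for ANY `eS : S(H₀)(ℚ) → S(H')(ℚ)` and `F : S(H₀)(K) → S(H')(K)` acting diagonally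
(over `ℚ`, resp. on `K`-points), `F` on the `ℚ`-point `g_K` is the base change of `eS g`.
[cite: Milne1999LefschetzClasses, §1 p. 644 L20–L21 («up to a unique isomorphism»), Prop. 1.5 and Remark 1.6] -/
theorem Polarization.coe_map_glBaseChange_eq_glBaseChange_map_of_forall_apply_hom_eq (ψ₀ : Polarization H₀) (ψ' : Polarization H')
    (eS : ψ₀.lefschetzGroup → ψ'.lefschetzGroup)
    (heS : ∀ (g₀ : ψ₀.lefschetzGroup) (i : ι) (x : W₀),
      ((eS g₀ : ψ'.lefschetzGroup) : V' ≃ₗ[ℚ] V') (((r i).toLinearMap x : (T i).toSubmodule) : V') =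
        (((r i).toLinearMap ((g₀ : W₀ ≃ₗ[ℚ] W₀) x) : (T i).toSubmodule) : V'))
    (F : ψ₀.lefschetzGroupBaseChange K → ψ'.lefschetzGroupBaseChange K)
    (hF : ∀ (g : ψ₀.lefschetzGroupBaseChange K) (i : ι) (x : K ⊗[ℚ] W₀),
      ((F g : ψ'.lefschetzGroupBaseChange K) : (K ⊗[ℚ] V') ≃ₗ[K] (K ⊗[ℚ] V')) (((T i).toSubmodule.subtype ∘ₗ (r i).toLinearMap).baseChange K x) =
        ((T i).toSubmodule.subtype ∘ₗ (r i).toLinearMap).baseChange K ((g : (K ⊗[ℚ] W₀) ≃ₗ[K] (K ⊗[ℚ] W₀)) x))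
    (g₀ : ψ₀.lefschetzGroup) :
    ((F ⟨glBaseChange K W₀ (g₀ : W₀ ≃ₗ[ℚ] W₀),
          Subgroup.mem_comap.1 (ψ₀.lefschetzGroup_le_comap_lefschetzGroupBaseChange K g₀.2)⟩ : ψ'.lefschetzGroupBaseChange K) :
        (K ⊗[ℚ] V') ≃ₗ[K] (K ⊗[ℚ] V')) =
      glBaseChange K V' ((eS g₀ : ψ'.lefschetzGroup) : V' ≃ₗ[ℚ] V') := by
  have hq : ∀ i, (((eS g₀ : ψ'.lefschetzGroup) : V' ≃ₗ[ℚ] V') : Module.End ℚ V') ∘ₗ ((T i).toSubmodule.subtype ∘ₗ (r i).toLinearMap) =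
      ((T i).toSubmodule.subtype ∘ₗ (r i).toLinearMap) ∘ₗ ((g₀ : W₀ ≃ₗ[ℚ] W₀) : Module.End ℚ W₀) := fun i =>
    LinearMap.ext fun x => by
      rw [LinearMap.comp_apply, LinearMap.comp_apply, LinearMap.comp_apply, LinearMap.comp_apply, Submodule.subtype_apply,
        Submodule.subtype_apply, LinearEquiv.coe_coe, LinearEquiv.coe_coe]
      exact heS g₀ i x
  have h1 : ∀ i, (((F ⟨glBaseChange K W₀ (g₀ : W₀ ≃ₗ[ℚ] W₀),
      Subgroup.mem_comap.1 (ψ₀.lefschetzGroup_le_comap_lefschetzGroupBaseChange K g₀.2)⟩ : ψ'.lefschetzGroupBaseChange K) :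
        (K ⊗[ℚ] V') ≃ₗ[K] (K ⊗[ℚ] V')) : Module.End K (K ⊗[ℚ] V')) ∘ₗ ((T i).toSubmodule.subtype ∘ₗ (r i).toLinearMap).baseChange K =
          ((T i).toSubmodule.subtype ∘ₗ (r i).toLinearMap).baseChange K ∘ₗ
            (((g₀ : W₀ ≃ₗ[ℚ] W₀).baseChange ℚ K W₀ W₀ : (K ⊗[ℚ] W₀) ≃ₗ[K] (K ⊗[ℚ] W₀)) : Module.End K (K ⊗[ℚ] W₀)) := fun i =>
    LinearMap.ext fun x => hF _ i x
  have h2 : ∀ i, ((T i).toSubmodule.subtype ∘ₗ (r i).toLinearMap).baseChange K ∘ₗ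
      (((g₀ : W₀ ≃ₗ[ℚ] W₀).baseChange ℚ K W₀ W₀ : (K ⊗[ℚ] W₀) ≃ₗ[K] (K ⊗[ℚ] W₀)) : Module.End K (K ⊗[ℚ] W₀)) =
        ((((eS g₀ : ψ'.lefschetzGroup) : V' ≃ₗ[ℚ] V').baseChange ℚ K V' V' : (K ⊗[ℚ] V') ≃ₗ[K] (K ⊗[ℚ] V')) :
          Module.End K (K ⊗[ℚ] V')) ∘ₗ ((T i).toSubmodule.subtype ∘ₗ (r i).toLinearMap).baseChange K := fun i => by
    rw [LinearEquiv.coe_baseChange, LinearEquiv.coe_baseChange, ← LinearMap.baseChange_comp, ← LinearMap.baseChange_comp, hq i]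
  exact LinearEquiv.toLinearMap_injective
    (linearMap_eq_of_forall_apply_baseChange_hom_eq K T hT r hr _ _ fun i x => LinearMap.congr_fun ((h1 i).trans (h2 i)) x)

end Diagonal

/-! ## §3 The canonical block `U ≤ S` -/

section CanonicalBlock

variable {V : Type u} [AddCommGroup V] [Module ℚ V] {H : HodgeStructure V n} {S U : SubHodgeStructure H}
  (hUS : U.toSubmodule ≤ S.toSubmodule)

include hUS

/-- **`E(γ_K) = (e γ)_K` for the canonical block**: for ANY `e : C(S) → C(U)` over the restriction (`(e γ) u = γ u`) and ANY
`E : C(S)(K) → C(U)(K)` over the base-changed restriction (`(ι_U)_K ((E c) x) = (ι_S)_K (c (j_K x))`), `E(γ_K) = (e γ)_K` (`(ι_U)_K` is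
injective). [cite: Milne1999LefschetzClasses, §1 p. 643 L12–L13, Prop. 1.1 and Remark 1.6 (p. 644)] [cite: BourbakiAlgebraI1989, Ch. II §5 no. 3 Prop. 7] -/
theorem coe_map_baseChange_eq_baseChange_coe_map_of_le
    (e : Subalgebra.centralizer ℚ (S.toHodgeStructure.endAlg : Set (Module.End ℚ S.toSubmodule)) →
      Subalgebra.centralizer ℚ (U.toHodgeStructure.endAlg : Set (Module.End ℚ U.toSubmodule)))
    (he : ∀ (γ : Subalgebra.centralizer ℚ (S.toHodgeStructure.endAlg : Set (Module.End ℚ S.toSubmodule))) (u : U.toSubmodule),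
      (((e γ : Subalgebra.centralizer ℚ (U.toHodgeStructure.endAlg : Set (Module.End ℚ U.toSubmodule))) :
          Module.End ℚ U.toSubmodule) u : V) = (((γ : Module.End ℚ S.toSubmodule) ⟨u, hUS u.2⟩ : S.toSubmodule) : V))
    (E : Subalgebra.centralizer K ((fun a : Module.End ℚ S.toSubmodule => a.baseChange K) ''
        (S.toHodgeStructure.endAlg : Set (Module.End ℚ S.toSubmodule))) →
      Subalgebra.centralizer K ((fun a : Module.End ℚ U.toSubmodule => a.baseChange K) ''
        (U.toHodgeStructure.endAlg : Set (Module.End ℚ U.toSubmodule))))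
    (hE : ∀ (c : Subalgebra.centralizer K ((fun a : Module.End ℚ S.toSubmodule => a.baseChange K) ''
        (S.toHodgeStructure.endAlg : Set (Module.End ℚ S.toSubmodule)))) (x : K ⊗[ℚ] U.toSubmodule),
      U.toSubmodule.subtype.baseChange K
          (((E c : Subalgebra.centralizer K ((fun a : Module.End ℚ U.toSubmodule => a.baseChange K) ''
            (U.toHodgeStructure.endAlg : Set (Module.End ℚ U.toSubmodule)))) : Module.End K (K ⊗[ℚ] U.toSubmodule)) x) =
        S.toSubmodule.subtype.baseChange K ((c : Module.End K (K ⊗[ℚ] S.toSubmodule)) ((Submodule.inclusion hUS).baseChange K x)))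
    (γ : Subalgebra.centralizer ℚ (S.toHodgeStructure.endAlg : Set (Module.End ℚ S.toSubmodule))) :
    ((E ⟨(γ : Module.End ℚ S.toSubmodule).baseChange K, baseChange_mem_centralizer_endAlg_baseChange K γ.2⟩ : Subalgebra.centralizer K
        ((fun a : Module.End ℚ U.toSubmodule => a.baseChange K) '' (U.toHodgeStructure.endAlg : Set (Module.End ℚ U.toSubmodule)))) :
          Module.End K (K ⊗[ℚ] U.toSubmodule)) =
      ((e γ : Subalgebra.centralizer ℚ (U.toHodgeStructure.endAlg : Set (Module.End ℚ U.toSubmodule))) :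
        Module.End ℚ U.toSubmodule).baseChange K := by
  have hinj : Function.Injective (U.toSubmodule.subtype.baseChange K) := by
    rw [LinearMap.baseChange_eq_ltensor]
    exact Module.Flat.lTensor_preserves_injective_linearMap _ U.toSubmodule.injective_subtype
  have hq : U.toSubmodule.subtype ∘ₗ ((e γ : Subalgebra.centralizer ℚ (U.toHodgeStructure.endAlg : Set (Module.End ℚ U.toSubmodule))) :
      Module.End ℚ U.toSubmodule) = S.toSubmodule.subtype ∘ₗ (γ : Module.End ℚ S.toSubmodule) ∘ₗ Submodule.inclusion hUS :=
    LinearMap.ext fun u => by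
      rw [LinearMap.comp_apply, Submodule.subtype_apply, LinearMap.comp_apply, LinearMap.comp_apply, Submodule.subtype_apply, he]
      rfl
  refine LinearMap.ext fun x => hinj ?_
  rw [hE, ← LinearMap.comp_apply (U.toSubmodule.subtype.baseChange K), ← LinearMap.baseChange_comp, hq, LinearMap.baseChange_comp,
    LinearMap.baseChange_comp, LinearMap.comp_apply, LinearMap.comp_apply]

/-- **`F(g_K) = (eS g)_K` for the canonical block on `S`**: for ANY `eS : S(S)(ℚ) → S(U)(ℚ)` over the restriction and ANY
`F : S(S)(K) → S(U)(K)` over the base-changed restriction, `F` on the `ℚ`-point `g_K` is the base change of `eS g`.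
[cite: Milne1999LefschetzClasses, §1 Prop. 1.5 and Remark 1.6 (p. 644)] [cite: BourbakiAlgebraI1989, Ch. II §5 no. 3 Prop. 7] -/
theorem Polarization.coe_map_glBaseChange_eq_glBaseChange_map_of_le (ψ : Polarization H)
    (eS : (ψ.restrict S).lefschetzGroup → (ψ.restrict U).lefschetzGroup)
    (heS : ∀ (g : (ψ.restrict S).lefschetzGroup) (u : U.toSubmodule),
      (((eS g : (ψ.restrict U).lefschetzGroup) : U.toSubmodule ≃ₗ[ℚ] U.toSubmodule) u : V) =
        (((g : S.toSubmodule ≃ₗ[ℚ] S.toSubmodule) ⟨u, hUS u.2⟩ : S.toSubmodule) : V))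
    (F : (ψ.restrict S).lefschetzGroupBaseChange K → (ψ.restrict U).lefschetzGroupBaseChange K)
    (hF : ∀ (g : (ψ.restrict S).lefschetzGroupBaseChange K) (x : K ⊗[ℚ] U.toSubmodule),
      U.toSubmodule.subtype.baseChange K
          (((F g : (ψ.restrict U).lefschetzGroupBaseChange K) : (K ⊗[ℚ] U.toSubmodule) ≃ₗ[K] (K ⊗[ℚ] U.toSubmodule)) x) =
        S.toSubmodule.subtype.baseChange K
          ((g : (K ⊗[ℚ] S.toSubmodule) ≃ₗ[K] (K ⊗[ℚ] S.toSubmodule)) ((Submodule.inclusion hUS).baseChange K x)))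
    (g : (ψ.restrict S).lefschetzGroup) :
    ((F ⟨glBaseChange K S.toSubmodule (g : S.toSubmodule ≃ₗ[ℚ] S.toSubmodule),
          Subgroup.mem_comap.1 ((ψ.restrict S).lefschetzGroup_le_comap_lefschetzGroupBaseChange K g.2)⟩ :
        (ψ.restrict U).lefschetzGroupBaseChange K) : (K ⊗[ℚ] U.toSubmodule) ≃ₗ[K] (K ⊗[ℚ] U.toSubmodule)) =
      glBaseChange K U.toSubmodule ((eS g : (ψ.restrict U).lefschetzGroup) : U.toSubmodule ≃ₗ[ℚ] U.toSubmodule) := by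
  have hinj : Function.Injective (U.toSubmodule.subtype.baseChange K) := by
    rw [LinearMap.baseChange_eq_ltensor]
    exact Module.Flat.lTensor_preserves_injective_linearMap _ U.toSubmodule.injective_subtype
  have hq : U.toSubmodule.subtype ∘ₗ (((eS g : (ψ.restrict U).lefschetzGroup) : U.toSubmodule ≃ₗ[ℚ] U.toSubmodule) :
      Module.End ℚ U.toSubmodule) =
        S.toSubmodule.subtype ∘ₗ ((g : S.toSubmodule ≃ₗ[ℚ] S.toSubmodule) : Module.End ℚ S.toSubmodule) ∘ₗ Submodule.inclusion hUS :=
    LinearMap.ext fun u => by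
      rw [LinearMap.comp_apply, Submodule.subtype_apply, LinearMap.comp_apply, LinearMap.comp_apply, Submodule.subtype_apply,
        LinearEquiv.coe_coe, LinearEquiv.coe_coe, heS]
      rfl
  have h2 : S.toSubmodule.subtype.baseChange K ∘ₗ (((g : S.toSubmodule ≃ₗ[ℚ] S.toSubmodule).baseChange ℚ K _ _ :
      (K ⊗[ℚ] S.toSubmodule) ≃ₗ[K] (K ⊗[ℚ] S.toSubmodule)) : Module.End K (K ⊗[ℚ] S.toSubmodule)) ∘ₗ
        (Submodule.inclusion hUS).baseChange K =
      U.toSubmodule.subtype.baseChange K ∘ₗ ((((eS g : (ψ.restrict U).lefschetzGroup) : U.toSubmodule ≃ₗ[ℚ] U.toSubmodule).baseChange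
        ℚ K _ _ : (K ⊗[ℚ] U.toSubmodule) ≃ₗ[K] (K ⊗[ℚ] U.toSubmodule)) : Module.End K (K ⊗[ℚ] U.toSubmodule)) := by
    rw [LinearEquiv.coe_baseChange, LinearEquiv.coe_baseChange, ← LinearMap.baseChange_comp, ← LinearMap.baseChange_comp,
      ← LinearMap.baseChange_comp, hq]
  refine LinearEquiv.ext fun x => hinj ?_
  rw [hF]
  exact LinearMap.congr_fun h2 x

end CanonicalBlock

end HodgeStructure

end Literature.AlgebraicGeometry.Motives
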